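import Summits.BirchSwinnertonDyer.BirchSwinnertonDyer.Theorems.EisensteinPrimesAcTwistDeformationSurAtVbarFin
import Summits.BirchSwinnertonDyer.BirchSwinnertonDyer.Theorems.EisensteinPrimesAcTwistDeformationCurveSurAtVbarOfTate
import Summits.BirchSwinnertonDyer.BirchSwinnertonDyer.Theorems.EisensteinPrimesAcTwistDeformationSurAtVbarOfTate
import Literature.NumberTheory.IwasawaTheory.Greenberg2006.CohomologyCofiniteGenerationLeTwoOfTate
import HarnessLib

/-!
# T28 re-typing (`OfTate`) of `EisensteinPrimesAcTwistDeformationSurAtVbarFin.lean`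

Route `EisensteinPrimes` (rung K5), crux 2 `GoodLatticeBDPValue` (stmt-BirchSwinnertonDyer-19032), line `halves`;
cell `bsd-eis`, seat `bsd-line-x1-p1` LEAD g8, lane «T28 / TATE RE-PLUMB» (helper, `--supports`).

This file re-types, token for token, the theorems of `EisensteinPrimesAcTwistDeformationSurAtVbarFin` that carry
Greenberg 2006 Prop. 3.2 BY NAME (`h32 : (∀ (L : Type) [Field L] [NumberField L], Literature.NumberTheory.GaloisCohomology.tateGlobalEulerPoincareCharacteristic L)`, cofinite generation of
`Hⁱ(K_Σ/K, 𝒟)` / `Hⁱ(K_v, 𝒟)` for EVERY `i`, every number field, every prime) with that hypothesis replaced by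
Tate's global Euler–Poincaré characteristic BY NAME for every number field
(`h32 : ∀ L, GaloisCohomology.tateGlobalEulerPoincareCharacteristic L`, Milne ADT I Thm. 5.1): on this line
Prop. 3.2 is read in degrees `i ≤ 2` only (global clause; the local clause is the unconditional
`Greenberg2006.prop32_local_holds`), and in those degrees it follows from Tate's formula alone
(`Greenberg2006.prop32_global_le_two_of_tate`, file `CohomologyCofiniteGenerationLeTwoOfTate`: `H⁰`/`H¹` of
`G_{K,S}` with finite coefficients are finite unconditionally, `H²` by Tate, and Greenberg's dévissage for `Hⁿ`
involves `Hⁿ`, `Hⁿ⁻¹` only).  Statements are otherwise VERBATIM (same binder order, new names `<name>_ofTate`);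
proofs are the tree proofs with the two reading lemmas substituted and the re-typed callees called.
EFFECT for the crux: Harari Thm. 17.13 (a) (`poitouTate_restricted_three_le`) is no longer consumed through
Prop. 3.2 at every number field, only at totally complex fields (Greenberg 2006 Prop. 4.1 is typed totally
imaginary; `cd_p ≤ 2` and the `H²` bookkeeping at the imaginary quadratic `K`), which is what the tree's
class-formation road (`RestrictedRamificationCdTwoOfH3Mu`, lane PT3-TC) proves.

Theorems only; no definition, no named fact, no `sorry`, no instance. HONEST FRAMING: conditional on the PUBLISHED
named facts carried as hypotheses; closes nothing by itself; no summit statement / BSD / the crux is proved here.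

## References
* R. Greenberg, *On the structure of certain Galois cohomology groups*, Doc. Math. Extra Vol. Coates (2006), Prop. 3.2 (p. 358). [Greenberg2006]
* J. S. Milne, *Arithmetic Duality Theorems*, 2nd ed. (2006), I Thm. 5.1 (p. 67). [MilneADT2006]
* (the references of the re-typed file apply verbatim)
-/

set_option autoImplicit false

noncomputable section

open scoped Classical
open NumberField IsDedekindDomain Field Multiplicative PowerSeries WeierstrassCurve
open Literature.NumberTheory.EllipticCurves Literature.NumberTheory.EllipticCurves.GreenbergSelmer
  Literature.NumberTheory.EllipticCurves.GreenbergVatsal2000 Literature.NumberTheory.GaloisRepresentations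
  Literature.NumberTheory.EllipticCurves.KellerYin2024 Literature.NumberTheory.EllipticCurves.IwasawaDual
  Literature.NumberTheory.EllipticCurves.Castella2018.AcSelmer
  Literature.NumberTheory.IwasawaTheory Literature.NumberTheory.IwasawaTheory.Greenberg2016
  Literature.NumberTheory.IwasawaTheory.Greenberg2006

namespace Summit.BirchSwinnertonDyer.BirchSwinnertonDyer.Theorems.AcTwistDeformation

section SurAtVbarFin

variable {K : Type} [Field K] [NumberField K] {p : ℕ} [Fact p.Prime]

/-- **[T28 `OfTate` re-typing: Greenberg 2006 Prop. 3.2 by name ↦ Milne ADT I Thm. 5.1 by name (Prop. 3.2 is read in degrees ≤ 2 only, `prop32_global_le_two_of_tate`).]** [cite: MilneADT2006, I Thm. 5.1 (p. 67)] **S1 in the LEAD's currency — SUR_θ at `v̄`, `Fin (p^c)`-families, given exponent.** For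
`θ ∈ {θsub, θquot}` of a residual pair of `E[p]` over the imaginary quadratic `K` ((Heeg) for `N_E`,
`2 < p = v v̄`), `κ` anticyclotomic with topological generator `γ`, `Sf` the places over `N_E`, [RH] for
`θ` at `S₀ = ∅` and the five Greenberg facts by name: for every `c` with `κ(D_v̄) = p^c ℤ_p` exactly and
every `y : Fin (p^c) → H¹(ker κ ⊓ D_v̄, (F/𝒪)(θ))` there is `u ∈ unramifiedOutside κ.kerSubgroup (F/𝒪)(θ) p ↑Sf`
with `res_{ker κ ⊓ D_v̄}(conj_{γ^i} u) = y i` for all `i : Fin (p^c)` — hypothesis `hsur` of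
`ResidualIndexAssembly.zpCorank_datumStrictSelmer_add_eq` at `H = κ.kerSubgroup`, `𝔭 = v̄`, `S₀ = ↑Sf`,
`τ = (γ ^ ·)`. From p642242. [cite: Greenberg2016Selmer, Prop. 2.6.3 (c), §4.3 pp. 20–21]
[cite: KellerYin2024, Rem. 1.4.2 (arXiv:2402.12781v2 TeX L1130–1140)] -/
theorem char_forall_fin_exists_unramifiedOutside_resOfLe_conjH1_pow_eq_ofTate (h263 : prop263_sur_of_crk)
    (h41 : prop41_globalEulerPoincareCorank) (h42 : prop42_localEulerPoincareCorank)
    (h5A : sec5A_localH2_subsingleton_of_LOC1) (h32 : (∀ (L : Type) [Field L] [NumberField L], Literature.NumberTheory.GaloisCohomology.tateGlobalEulerPoincareCharacteristic L))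
    (W : WeierstrassCurve ℚ) [W.IsElliptic] (hp : 2 < p) (hK : IsImaginaryQuadratic K)
    (hH : SatisfiesHeegnerHypothesis (W.conductorNorm ℤ) K)
    {ι : K →+* ℚ_[p]} {v vbar : HeightOneSpectrum (𝓞 K)}
    (hvι : ∀ x : 𝓞 K, x ∈ v.asIdeal ↔ ‖ι (x : K)‖ < 1)
    (hvbar : ((p : ℕ) : 𝓞 K) ∈ vbar.asIdeal) (hne : vbar ≠ v)
    (κ : ZpExtension K p) (hκ : κ.IsAnticyclotomic) (γ : absoluteGaloisGroup K)
    [Fact (κ.IsTopGenerator γ)]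
    {θsub θquot : FramedGaloisRep K (padicCoeffIntegers (∅ : Set (PadicAlgCl p))) 1}
    (hpair : IsResidualPairOver (W.baseChange K) p θsub θquot)
    (Sf : Finset (HeightOneSpectrum (𝓞 K)))
    (hSf : ∀ w : HeightOneSpectrum (𝓞 K), w ∈ Sf ↔ ((W.conductorNorm ℤ : ℤ) : 𝓞 K) ∈ w.asIdeal)
    (θ : FramedGaloisRep K (padicCoeffIntegers (∅ : Set (PadicAlgCl p))) 1) (hθ : θ = θsub ∨ θ = θquot)
    (hRH : ∀ D : DatumDualData κ γ (charModule (∅ : Set (PadicAlgCl p)) θ)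
        (Castella2018.AcSelmer.bdpData (charModule (∅ : Set (PadicAlgCl p)) θ) p vbar)
        (∅ : Set (HeightOneSpectrum (𝓞 K))),
      Module.Finite (IwasawaAlgebra p) D.X ∧ Module.IsTorsion (IwasawaAlgebra p) D.X ∧
        muInvariant p D.X = 0)
    (c : ℕ) (hc : ∃ δ ∈ decomp (K := K) vbar, (κ δ).toAdd = (p : ℤ_[p]) ^ c)
    (hcd : ∀ δ ∈ decomp (K := K) vbar, (p : ℤ_[p]) ^ c ∣ (κ δ).toAdd) :
    ∀ y : Fin (p ^ c) →
        subgroupH1 (κ.kerSubgroup ⊓ decomp (K := K) vbar) (charModule (∅ : Set (PadicAlgCl p)) θ),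
      ∃ u ∈ unramifiedOutside κ.kerSubgroup (charModule (∅ : Set (PadicAlgCl p)) θ) p
          (↑Sf : Set (HeightOneSpectrum (𝓞 K))),
        ∀ i : Fin (p ^ c),
          resOfLe (charModule (∅ : Set (PadicAlgCl p)) θ)
            (inf_le_left : κ.kerSubgroup ⊓ decomp (K := K) vbar ≤ κ.kerSubgroup)
            (conjH1 κ.kerSubgroup (charModule (∅ : Set (PadicAlgCl p)) θ) (γ ^ (i : ℕ)) u) = y i := by
  obtain ⟨c', hc', hc'd, hsur⟩ := exists_forall_resOfLe_conjH1_pow_eq_at_vbar_of_RH_ofTate h263 h41 h42 h5A h32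
    W hp hK hH hvι hvbar hne κ hκ γ hpair Sf hSf θ hθ hRH
  obtain rfl : c = c' := eq_of_pow_generates κ (decomp (K := K) vbar) hc hcd hc' hc'd
  exact forall_fin_of_forall_nat
    (fun u ↦ u ∈ unramifiedOutside κ.kerSubgroup (charModule (∅ : Set (PadicAlgCl p)) θ) p
      (↑Sf : Set (HeightOneSpectrum (𝓞 K))))
    (fun i u ↦ resOfLe (charModule (∅ : Set (PadicAlgCl p)) θ)
      (inf_le_left : κ.kerSubgroup ⊓ decomp (K := K) vbar ≤ κ.kerSubgroup)
      (conjH1 κ.kerSubgroup (charModule (∅ : Set (PadicAlgCl p)) θ) (γ ^ i) u))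
    fun y ↦ by
      obtain ⟨u, hu, -, hev⟩ := hsur y
      exact ⟨u, hu, hev⟩

/-- **[T28 `OfTate` re-typing: Greenberg 2006 Prop. 3.2 by name ↦ Milne ADT I Thm. 5.1 by name (Prop. 3.2 is read in degrees ≤ 2 only, `prop32_global_le_two_of_tate`).]** [cite: MilneADT2006, I Thm. 5.1 (p. 67)] **S2 in the LEAD's currency — SUR_f at `v̄`, `Fin (p^c)`-families, given exponent.** For
`E = W/ℚ` over the imaginary quadratic `K` ((Heeg) for `N_E`, `2 < p = v v̄`), `κ` anticyclotomic with
topological generator `γ`, a residual pair `θsub, θquot`, `Sf` the places over `N_E`, the `Sf`-imprimitive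
cotorsion of the two characters (`hSsub`, `hSquot`) and the five Greenberg facts by name: for every `c`
with `κ(D_v̄) = p^c ℤ_p` exactly and every `y : Fin (p^c) → H¹(ker κ ⊓ D_v̄, E_K[p^∞])` there is
`u ∈ unramifiedOutside κ.kerSubgroup (E_K.geomPrimaryTorsion p) p ↑Sf` with
`res_{ker κ ⊓ D_v̄}(conj_{γ^i} u) = y i` for all `i : Fin (p^c)` — hypothesis `hsur` of
`ResidualIndexAssembly.zpCorank_datumStrictSelmer_add_eq` at `A = E_K[p^∞]`, `H = κ.kerSubgroup`,
`𝔭 = v̄`, `S₀ = ↑Sf`, `τ = (γ ^ ·)`. From p646772. [cite: Greenberg2016Selmer, Prop. 2.6.3 (c), §4.3 pp. 20–21]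
[cite: Greenberg2006, Thm. 3 p. 342, Props. 3.2, 4.1, 4.2, §5 A] [cite: KellerYin2024, Rem. 1.4.2 (arXiv:2402.12781v2 TeX L1130–1140)] -/
theorem curve_forall_fin_exists_unramifiedOutside_resOfLe_conjH1_pow_eq_ofTate (h263 : prop263_sur_of_crk)
    (h41 : prop41_globalEulerPoincareCorank) (h42 : prop42_localEulerPoincareCorank)
    (h5A : sec5A_localH2_subsingleton_of_LOC1) (h32 : (∀ (L : Type) [Field L] [NumberField L], Literature.NumberTheory.GaloisCohomology.tateGlobalEulerPoincareCharacteristic L))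
    (W : WeierstrassCurve ℚ) [W.IsElliptic] (hp : 2 < p) (hK : IsImaginaryQuadratic K)
    (hH : SatisfiesHeegnerHypothesis (W.conductorNorm ℤ) K)
    {ι : K →+* ℚ_[p]} {v vbar : HeightOneSpectrum (𝓞 K)}
    (hvι : ∀ x : 𝓞 K, x ∈ v.asIdeal ↔ ‖ι (x : K)‖ < 1)
    (hvbar : ((p : ℕ) : 𝓞 K) ∈ vbar.asIdeal) (hne : vbar ≠ v)
    (κ : ZpExtension K p) (hκ : κ.IsAnticyclotomic) (γ : absoluteGaloisGroup K)
    [Fact (κ.IsTopGenerator γ)]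
    {θsub θquot : FramedGaloisRep K (padicCoeffIntegers (∅ : Set (PadicAlgCl p))) 1}
    (hpair : IsResidualPairOver (W.baseChange K) p θsub θquot)
    (Sf : Finset (HeightOneSpectrum (𝓞 K)))
    (hSf : ∀ w : HeightOneSpectrum (𝓞 K), w ∈ Sf ↔ ((W.conductorNorm ℤ : ℤ) : 𝓞 K) ∈ w.asIdeal)
    (hSsub : ∀ D : DatumDualData κ γ (charModule (∅ : Set (PadicAlgCl p)) θsub)
      (bdpData (charModule (∅ : Set (PadicAlgCl p)) θsub) p vbar) (↑Sf : Set (HeightOneSpectrum (𝓞 K))),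
      Module.Finite (IwasawaAlgebra p) D.X ∧ Module.IsTorsion (IwasawaAlgebra p) D.X ∧
        muInvariant p D.X = 0)
    (hSquot : ∀ D : DatumDualData κ γ (charModule (∅ : Set (PadicAlgCl p)) θquot)
      (bdpData (charModule (∅ : Set (PadicAlgCl p)) θquot) p vbar) (↑Sf : Set (HeightOneSpectrum (𝓞 K))),
      Module.Finite (IwasawaAlgebra p) D.X ∧ Module.IsTorsion (IwasawaAlgebra p) D.X ∧
        muInvariant p D.X = 0)
    (c : ℕ) (hc : ∃ δ ∈ decomp (K := K) vbar, (κ δ).toAdd = (p : ℤ_[p]) ^ c)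
    (hcd : ∀ δ ∈ decomp (K := K) vbar, (p : ℤ_[p]) ^ c ∣ (κ δ).toAdd) :
    ∀ y : Fin (p ^ c) →
        subgroupH1 (κ.kerSubgroup ⊓ decomp (K := K) vbar) ((W.baseChange K).geomPrimaryTorsion p),
      ∃ u ∈ unramifiedOutside κ.kerSubgroup ((W.baseChange K).geomPrimaryTorsion p) p
          (↑Sf : Set (HeightOneSpectrum (𝓞 K))),
        ∀ i : Fin (p ^ c),
          resOfLe ((W.baseChange K).geomPrimaryTorsion p)
            (inf_le_left : κ.kerSubgroup ⊓ decomp (K := K) vbar ≤ κ.kerSubgroup)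
            (conjH1 κ.kerSubgroup ((W.baseChange K).geomPrimaryTorsion p) (γ ^ (i : ℕ)) u) = y i := by
  obtain ⟨c', hc', hc'd, hsur⟩ := curve_exists_forall_resOfLe_conjH1_pow_eq_at_vbar_ofTate h263 h41 h42 h5A h32
    W hp hK hH hvι hvbar hne κ hκ γ hpair Sf hSf hSsub hSquot
  obtain rfl : c = c' := eq_of_pow_generates κ (decomp (K := K) vbar) hc hcd hc' hc'd
  exact forall_fin_of_forall_nat
    (fun u ↦ u ∈ unramifiedOutside κ.kerSubgroup ((W.baseChange K).geomPrimaryTorsion p) p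
      (↑Sf : Set (HeightOneSpectrum (𝓞 K))))
    (fun i u ↦ resOfLe ((W.baseChange K).geomPrimaryTorsion p)
      (inf_le_left : κ.kerSubgroup ⊓ decomp (K := K) vbar ≤ κ.kerSubgroup)
      (conjH1 κ.kerSubgroup ((W.baseChange K).geomPrimaryTorsion p) (γ ^ i) u))
    fun y ↦ by
      obtain ⟨u, hu, -, hev⟩ := hsur y
      exact ⟨u, hu, hev⟩

end SurAtVbarFin

end Summit.BirchSwinnertonDyer.BirchSwinnertonDyer.Theorems.AcTwistDeformation

end
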